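import Summits.Ventures.LatticeQCDFlow.Scaling.HomStarPersistentLogFloor

/-!
HONEST FRAMING: exact (Metropolis-corrected) sampling algorithms for lattice gauge theory; figures
of merit are autocorrelation/cost numbers at stated couplings and volumes; no continuum-physics
claim.

# PersistentColdStart — FROM THE COLD START (EVERY PARTICLE ∕ REPLICA AT THE DISTINGUISHED CONTENT `u`) THE LUMPED STAR's LAZY ∕ POOLED CHAIN, AND THE VENTURE's HOMOGENEOUS
# SCHEME ITSELF, STAY AT TOTAL-VARIATION DISTANCE `≥ ½` FROM EQUILIBRIUM FOR EVERY `n ≤ (K/((t+h)Λ) − 1)·(½·log K − log(72(1+c)²e^{2c}/((1−g⋆)Λ)))` — WITH PERSISTENCE ON THE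
# ONE-DISTINGUISHED-CONTENT PATTERN, FOR EVERY HUB LAW (lean-2 GEN-46, ours)

Venture-side (OURS).  Cell `lqcd-flow` (pub-lqcd), unit `pub-lqcd-lean-2-g46`, 2026-08-31.  Chapter AF (the law-free `½·log K` with persistence), file 9 — the time-wise, start-specific
form of file 5 ∕ 6: file 1's distance floor `‖δ_xPⁿ − π‖_TV ≥ ½` while `λⁿ|Φ(x)| ≥ 2δ/(1−λ) + 4D`, at the `u`-crowded lumped state `x₁` (hub `u`, composition `(K+1)δ_u`), where
file 3's statistic has `Φ(x₁) = f(K) + κ(K) ≥ K(1−g⋆)e^{−c}` (`g⋆ = μ_1(u)` the equilibrium cold `u`-fraction); the law enters only through the factor `1 − g⋆` inside the logarithm.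
By AD9 the pooled law of chapter U's homogeneous scheme from the configuration `y_u ≡ u` IS `δ_{x₁}S_lⁿ` (`x₁ = Λy_u`), and by AE15 ∕ AD15 the configuration law is no closer to
`μ_0⊗μ_1⊗⋯⊗μ_1` than its pooled image is to `π_S`.  Hypothesis-equations only, no definitions.

* `persistent_floor_log_eta` (the logarithm with a start factor `η`), **`lumpedStar_lazy_coldStart_tvDist_ge_half`** (the lazy lumped chain from `x₁`), **`homStar_coldStart_tvDist_ge_half`**
  (the venture's homogeneous scheme from `y_u ≡ u`: pooled law against `π_S` AND configuration law against `μ_0⊗μ_1⊗⋯⊗μ_1`).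

Reading (no numerics implied): the physically natural start — all replicas in the same configuration — is the floor's witness whenever `μ_1(u) ≤ ½`, and for every `μ_1(u) < 1` up to the
factor `1 − μ_1(u)` inside the logarithm.  Literature grade (cell rule): OWN assembly on files 1–6; nothing cited; no new bib keys.
-/

noncomputable section

open Finset Function
open Literature.Probability.MarkovChains

namespace Summit.Ventures.LatticeQCDFlow.Scaling

/-- **THE LOGARITHM WITH A START FACTOR:** with `0 < Λ`, `K ≥ 1`, `E₁ ≥ 1`, `0 ≤ δ/(Λ/K) ≤ 4E₁/Λ`, `0 < η` and `Φ₀ ≥ Kηe^{−c}`: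
`log(Φ₀/(2δ/(Λ/K) + 4·7E₁√K/Λ)) ≥ ½·log K − log(36E₁e^c/(ηΛ))`. [ours] -/
theorem persistent_floor_log_eta {Λ K E₁ δ c η Φ₀ : ℝ} (hΛ0 : 0 < Λ) (hK : 1 ≤ K) (hE : 1 ≤ E₁) (hδ0 : 0 ≤ δ) (hδ : δ / (Λ / K) ≤ 4 * E₁ / Λ) (hη : 0 < η)
    (hΦ : K * η * Real.exp (-c) ≤ Φ₀) :
    Real.log K / 2 - Real.log (36 * E₁ * Real.exp c / (η * Λ)) ≤ Real.log (Φ₀ / (2 * δ / (Λ / K) + 4 * (7 * E₁ * Real.sqrt K / Λ))) := by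
  have hK0 : 0 < K := by linarith
  have hsK : 0 < Real.sqrt K := Real.sqrt_pos.mpr hK0
  have hsK1 : 1 ≤ Real.sqrt K := by rw [← Real.sqrt_one]; exact Real.sqrt_le_sqrt hK
  have hE0 : 0 < E₁ := by linarith
  have hec : 0 < Real.exp c := Real.exp_pos c
  have hΦ0 : 0 < Φ₀ := lt_of_lt_of_le (by positivity) hΦ
  have hM : 2 * δ / (Λ / K) + 4 * (7 * E₁ * Real.sqrt K / Λ) ≤ 36 * E₁ * Real.sqrt K / Λ := by
    have h1 : 2 * δ / (Λ / K) ≤ 8 * E₁ * Real.sqrt K / Λ := by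
      have e : 2 * δ / (Λ / K) = 2 * (δ / (Λ / K)) := by ring
      rw [e]
      calc 2 * (δ / (Λ / K)) ≤ 2 * (4 * E₁ / Λ) := by linarith
        _ = 8 * E₁ * 1 / Λ := by ring
        _ ≤ 8 * E₁ * Real.sqrt K / Λ := by
            apply div_le_div_of_nonneg_right _ hΛ0.le
            exact mul_le_mul_of_nonneg_left hsK1 (by positivity)
    have e2 : 8 * E₁ * Real.sqrt K / Λ + 4 * (7 * E₁ * Real.sqrt K / Λ) = 36 * E₁ * Real.sqrt K / Λ := by ring
    linarith
  have hMpos : 0 < 2 * δ / (Λ / K) + 4 * (7 * E₁ * Real.sqrt K / Λ) := by positivity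
  have hratio : Real.sqrt K / (36 * E₁ * Real.exp c / (η * Λ)) ≤ Φ₀ / (2 * δ / (Λ / K) + 4 * (7 * E₁ * Real.sqrt K / Λ)) := by
    have e : Real.sqrt K / (36 * E₁ * Real.exp c / (η * Λ)) = (K * η * Real.exp (-c)) / (36 * E₁ * Real.sqrt K / Λ) := by
      have hsq : Real.sqrt K * Real.sqrt K = K := Real.mul_self_sqrt hK0.le
      rw [Real.exp_neg]
      field_simp
      nlinarith [hsq]
    rw [e]
    calc K * η * Real.exp (-c) / (36 * E₁ * Real.sqrt K / Λ) ≤ Φ₀ / (36 * E₁ * Real.sqrt K / Λ) := div_le_div_of_nonneg_right hΦ (by positivity)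
      _ ≤ Φ₀ / (2 * δ / (Λ / K) + 4 * (7 * E₁ * Real.sqrt K / Λ)) := div_le_div_of_nonneg_left hΦ0.le hMpos hM
  have hlhs : 0 < Real.sqrt K / (36 * E₁ * Real.exp c / (η * Λ)) := by positivity
  calc Real.log K / 2 - Real.log (36 * E₁ * Real.exp c / (η * Λ)) = Real.log (Real.sqrt K / (36 * E₁ * Real.exp c / (η * Λ))) := by
        rw [Real.log_div hsK.ne' (by positivity), Real.log_sqrt hK0.le]
    _ ≤ Real.log (Φ₀ / (2 * δ / (Λ / K) + 4 * (7 * E₁ * Real.sqrt K / Λ))) := Real.log_le_log hlhs hratio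

section ColdStart
variable {X : Type*} [Fintype X] [DecidableEq X] {S : Type*} [Fintype S] [DecidableEq S]
variable {hub : X → S} {comp : X → S → ℕ} {K : ℕ} {μ0 W : S → ℝ} {σ : ℝ} {acc : S → S → ℝ} {Kh : (S → ℕ) → S → S → ℝ}
variable {Ast Bst Sst Sl : X → X → ℝ} {g : (S → ℕ) → ℝ} {πS : X → ℝ} {Z : ℝ}

/-- **FROM THE `u`-CROWDED STATE THE LAZY LUMPED CHAIN IS NOT HALF-MIXED BEFORE `(K/((t+h)Λ) − 1)·(½·log K − log(72(1+c)²e^{2c}/((1−g⋆)Λ)))`:** X5's data, the lazy chain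
`S_l = tA + hB + (1−t−h)I` (`0 < t`, `0 < h`, `t + h ≤ 1`), swap odds `σ = t/(t+h)` with `σ ≤ (1−σ)K`, `K ≥ 2`, `μ_0 > 0`, a content `u` with the pattern and another content, the constants
of file 3a at `p = μ_0(u)`, and the state `x₁` with hub `u` and composition `(K+1)δ_u`: for every `n` below the displayed bound, **`‖δ_{x₁}S_lⁿ − π_S‖_TV ≥ ½`**. [ours] -/
theorem lumpedStar_lazy_coldStart_tvDist_ge_half [Nonempty X] (hinj : ∀ x x', hub x = hub x' → comp x = comp x' → x = x')
    (hsurj : ∀ (z : S) (N : S → ℕ), ∑ v, N v = K + 1 → N z ≠ 0 → ∃ x, hub x = z ∧ comp x = N) (hhub : ∀ x, comp x (hub x) ≠ 0)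
    (hsum : ∀ x, ∑ v, comp x v = K + 1) (hK : 2 ≤ K) (hW : ∀ v, 0 < W v) (hacc : ∀ h v, acc h v = min 1 (W h / W v)) (hμ1 : ∑ v, μ0 v = 1) (hμpos : ∀ v, 0 < μ0 v)
    {t h σ : ℝ} (ht0 : 0 < t) (hh0 : 0 < h) (hth : t + h ≤ 1) (hσ : σ = t / (t + h)) (hKσ : σ ≤ (1 - σ) * K)
    (hKoff : ∀ N h v, h ≠ v → Kh N h v = if N h = 0 then 0 else (N v : ℝ) / K * acc h v) (hKdiag : ∀ N h, Kh N h h = 1 - ∑ v ∈ univ.erase h, Kh N h v)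
    (hA : ∀ x x', Ast x x' = if comp x' = comp x then Kh (comp x) (hub x) (hub x') else 0)
    (hB : ∀ x x', Bst x x' = μ0 (hub x') * (if comp x' + Pi.single (hub x) 1 = comp x + Pi.single (hub x') 1 then 1 else 0))
    (hSl : ∀ x x', Sl x x' = t * Ast x x' + h * Bst x x' + (1 - t - h) * (if x = x' then 1 else 0))
    (hg : ∀ N, g N = ∏ v, (μ0 v * W v) ^ (N v) / ((N v).factorial : ℝ))
    (hZ : Z = ∑ x, g (comp x) * ((comp x (hub x) : ℝ) / W (hub x))) (hπS : ∀ x, πS x = g (comp x) * ((comp x (hub x) : ℝ) / W (hub x)) / Z)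
    (u w : S) (hw : w ≠ u) {α β : ℝ} (hα0 : 0 < α) (hα1 : α ≤ 1) (hβ0 : 0 < β) (hβ1 : β ≤ 1)
    (hαu : ∀ v, v ≠ u → acc u v = α) (hβu : ∀ v, v ≠ u → acc v u = β)
    {cbar gs D0 Λ γ c : ℝ} (hcbar : cbar = μ0 u * α + (1 - μ0 u) * β) (hgs : gs = μ0 u * α / cbar) (hD0 : D0 = (1 - σ) + σ * α * β / cbar)
    (hΛ : Λ = σ * (1 - σ) * cbar / D0) (hγ : γ = σ * (β - α) / D0) (hc : c = σ / D0)
    (x₁ : X) (hx₁ : hub x₁ = u) (hcx₁ : comp x₁ = fun v => if v = u then K + 1 else 0) {n : ℕ}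
    (hn : (n : ℝ) ≤ ((K : ℝ) / ((t + h) * Λ) - 1) * (Real.log K / 2 - Real.log (72 * (1 + c) ^ 2 * Real.exp (2 * c) / ((1 - gs) * Λ)))) :
    1 / 2 ≤ tvDist (lawAt Sl (Pi.single x₁ 1) n) πS := by
  classical
  -- the swap odds
  set q : ℝ := t + h with hqdef
  have hq0 : 0 < q := by rw [hqdef]; linarith
  have hq1 : q ≤ 1 := hth
  have hσ0 : 0 < σ := by rw [hσ]; exact div_pos ht0 hq0
  have hσ1 : σ < 1 := by rw [hσ, div_lt_one hq0, hqdef]; linarith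
  have hσt : σ * q = t := by rw [hσ]; field_simp
  have hσh : (1 - σ) * q = h := by rw [hσ]; field_simp; ring
  -- the hub law of `u`
  have hp0 : 0 < μ0 u := hμpos u
  have hp1 : μ0 u < 1 := persistent_hubLaw_lt_one hμ1 hμpos hw
  have hK1 : 1 ≤ K := by omega
  have hK0 : (0 : ℝ) < K := by exact_mod_cast (show 0 < K by omega)
  have hK1r : (1 : ℝ) ≤ K := by exact_mod_cast hK1
  -- file 3a's constants
  have hgsb := pairEigen_gs_bounds hα0 hα1 hβ0 hβ1 hp0 hp1 hcbar hgs
  have hcc := pairEigen_c_bounds hσ0 hσ1 hα0 hα1 hβ0 hβ1 hp0 hp1 hcbar hD0 hc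
  have hΛb := pairEigen_Λ_bounds hσ0 hσ1 hα0 hα1 hβ0 hβ1 hp0 hp1 hcbar hD0 hΛ hc
  have hγc := pairEigen_abs_γ_le_c hσ0 hσ1 hα0 hα1 hβ0 hβ1 hp0 hp1 hcbar hD0 hγ hc
  have hcK : c ≤ K := by
    have h1 : σ / (1 - σ) ≤ K := by rw [div_le_iff₀ (by linarith)]; linarith
    exact le_trans hcc.2 h1
  -- the statistic
  set f : ℕ → ℝ := fun G => ((G : ℝ) - gs * K) * Real.exp (γ * (((G : ℝ) - gs * K) / K)) with hfdef
  set κ : ℕ → ℝ := fun G => c * ((α * ((K : ℝ) - G) + β * G) / K) * Real.exp (γ * (((G : ℝ) - gs * K) / K)) with hκdef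
  have hf : ∀ G : ℕ, f G = ((G : ℝ) - gs * K) * Real.exp (γ * (((G : ℝ) - gs * K) / K)) := fun G => rfl
  have hκ : ∀ G : ℕ, κ G = c * ((α * ((K : ℝ) - G) + β * G) / K) * Real.exp (γ * (((G : ℝ) - gs * K) / K)) := fun G => rfl
  set Gc : X → ℕ := fun x => comp x u - (if hub x = u then 1 else 0) with hGcdef
  have hG : ∀ x, Gc x = comp x u - (if hub x = u then 1 else 0) := fun x => rfl
  set Φ : X → ℝ := fun x => f (Gc x) + (if hub x = u then κ (Gc x) else 0) with hΦdef
  have hΦ : ∀ x, Φ x = f (Gc x) + (if hub x = u then κ (Gc x) else 0) := fun x => rfl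
  -- the auxiliary step chain at swap odds `σ`, and `S_l = qS_σ + (1−q)I`
  obtain ⟨Sst, hS⟩ : ∃ Sst : X → X → ℝ, ∀ x x', Sst x x' = σ * Ast x x' + (1 - σ) * Bst x x' :=
    ⟨fun x x' => σ * Ast x x' + (1 - σ) * Bst x x', fun _ _ => rfl⟩
  have hSl' : ∀ x x', Sl x x' = q * Sst x x' + (1 - q) * (if x = x' then 1 else 0) := by
    intro x x'
    rw [hSl, hS]
    have e1 : q * (σ * Ast x x' + (1 - σ) * Bst x x') = (σ * q) * Ast x x' + ((1 - σ) * q) * Bst x x' := by ring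
    rw [e1, hσt, hσh, hqdef]
    ring
  -- the chains: row-stochastic, `π_S` stationary, `S_l` `¼`-close at some time
  have hμ0 : ∀ v, 0 ≤ μ0 v := fun v => (hμpos v).le
  have hπ := lumpedStar_piS_pos hhub hW hμpos hg hZ hπS
  have hπ1 := lumpedStar_piS_sum hhub hW hμpos hg hZ hπS
  have hA0 : ∀ x x', 0 ≤ Ast x x' := starStep_swap_nonneg hW hacc hK1 hsum hKoff hKdiag hA
  have hA1 : ∀ x, ∑ x', Ast x x' = 1 := starStep_swap_rowsum hinj hsurj hhub hsum hKoff hKdiag hA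
  have hB0 : ∀ x x', 0 ≤ Bst x x' := fun x x' => by rw [hB]; exact mul_nonneg (hμ0 _) (by split_ifs <;> norm_num)
  have hB1 : ∀ x, ∑ x', Bst x x' = 1 := starStep_redraw_rowsum hinj hsurj hhub hsum hμ1 hB
  have hArev : ∀ x x', πS x * Ast x x' = πS x' * Ast x' x := starStep_swap_reversible hinj hhub hW hacc hKoff hA hπS
  have hBrev : ∀ x x', πS x * Bst x x' = πS x' * Bst x' x := starStep_redraw_reversible hhub hW hg hπS hB
  have hSrs : IsRowStochastic Sst := by
    refine ⟨fun x y => by rw [hS]; exact add_nonneg (mul_nonneg hσ0.le (hA0 x y)) (mul_nonneg (by linarith) (hB0 x y)), fun x => ?_⟩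
    simp_rw [hS]; rw [sum_add_distrib, ← mul_sum, ← mul_sum, hA1, hB1]; ring
  have hSlrs : IsRowStochastic Sl := lazyq_isRowStochastic hSrs hq0.le hq1 hSl'
  have hI : ∀ y, ∑ x, πS x * (if x = y then (1 : ℝ) else 0) = πS y := fun y => by
    simp only [mul_ite, mul_one, mul_zero, Finset.sum_ite_eq', Finset.mem_univ, if_true]
  have hst : IsStationary πS Sl := by
    intro y
    calc ∑ x, πS x * Sl x y = ∑ x, (t * (πS y * Ast y x) + h * (πS y * Bst y x) + (1 - t - h) * (πS x * (if x = y then 1 else 0))) :=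
          sum_congr rfl fun x _ => by rw [hSl, ← hArev, ← hBrev]; ring
      _ = t * (πS y * ∑ x, Ast y x) + h * (πS y * ∑ x, Bst y x) + (1 - t - h) * ∑ x, πS x * (if x = y then 1 else 0) := by
          rw [sum_add_distrib, sum_add_distrib, ← mul_sum, ← mul_sum, ← mul_sum, ← mul_sum, ← mul_sum]
      _ = πS y := by rw [hA1, hB1, hI]; ring
  -- the defect of `S_σ` (files 3b, 4), hence of `S_l`
  set δ : ℝ := 4 * c * (1 + c) * Real.exp c / K with hδdef
  have hE1 : ∀ G : ℕ, G ≤ K → |σ * α * (((K : ℝ) - G) / K) * (f (G + 1) - f G - κ G) - (1 - σ) * (1 - μ0 u) * κ G + Λ / K * (f G + κ G)| ≤ δ :=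
    fun G hGK => pairEigen_defect_one hσ0 hσ1 hα0 hα1 hβ0 hβ1 hp0 hp1 hcbar hgs hD0 hΛ hγ hc hf hκ hK1 hcK hGK
  have hE0 : ∀ G : ℕ, G ≤ K → |σ * β * ((G : ℝ) / K) * (f (G - 1) + κ (G - 1) - f G) + (1 - σ) * μ0 u * κ G + Λ / K * f G| ≤ δ :=
    fun G hGK => pairEigen_defect_zero hσ0 hσ1 hα0 hα1 hβ0 hβ1 hp0 hp1 hcbar hgs hD0 hΛ hγ hc hf hκ hK1 hcK hGK
  have hdefS : ∀ x, |∑ y, Sst x y * Φ y - (1 - Λ / K) * Φ x| ≤ δ :=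
    fun x => pair_step_defect hinj hsurj hhub hsum hμ1 hKoff hKdiag hA hB hS hαu hβu hG hΦ hE1 hE0 x
  set lam : ℝ := 1 - q * Λ / K with hlamdef
  have hsumSl : ∀ x, ∑ y, Sl x y * Φ y = q * ∑ y, Sst x y * Φ y + (1 - q) * Φ x := by
    intro x
    have e : ∀ y, Sl x y * Φ y = q * (Sst x y * Φ y) + (1 - q) * ((if x = y then (1 : ℝ) else 0) * Φ y) := fun y => by rw [hSl']; ring
    rw [sum_congr rfl fun y _ => e y, sum_add_distrib, ← mul_sum, ← mul_sum]
    congr 2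
    simp only [ite_mul, one_mul, zero_mul, Finset.sum_ite_eq, Finset.mem_univ, if_true]
  have hdef : ∀ x, |∑ y, Sl x y * Φ y - lam * Φ x| ≤ q * δ := by
    intro x
    rw [hsumSl x, hlamdef]
    have e : q * ∑ y, Sst x y * Φ y + (1 - q) * Φ x - (1 - q * Λ / K) * Φ x = q * (∑ y, Sst x y * Φ y - (1 - Λ / K) * Φ x) := by ring
    rw [e, abs_mul, abs_of_pos hq0]
    exact mul_le_mul_of_nonneg_left (hdefS x) hq0.le
  -- the jumps
  have hJc := persistent_jump_constants hcc.1.le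
  set E₁ : ℝ := (1 + c) ^ 2 * Real.exp c with hE₁def
  have hE₁1 : 1 ≤ E₁ := hJc.1
  have hJ₁ : ∀ G : ℕ, G ≤ K → |f (G + 1) - f G| ≤ 2 * (1 + c) ^ 2 * Real.exp c :=
    fun G hGK => pairEigen_f_succ_sub hσ0 hσ1 hα0 hα1 hβ0 hβ1 hp0 hp1 hcbar hgs hD0 hγ hc hf hK1 hcK hGK
  have hJ₂ : ∀ G : ℕ, G ≤ K → |κ G| ≤ c * Real.exp c := by
    intro G hGK
    have hb := pairEigen_κ_bounds hσ0 hσ1 hα0 hα1 hβ0 hβ1 hp0 hp1 hcbar hgs hD0 hγ hc hκ hK1 hGK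
    rw [abs_of_nonneg hb.1]; exact hb.2
  have hJ₁0 : 0 ≤ 2 * (1 + c) ^ 2 * Real.exp c := by positivity
  have hJ₂0 : 0 ≤ c * Real.exp c := by have := hcc.1; positivity
  have hRS : ∀ x, ∑ y, Sst x y * (Φ y - Φ x) ^ 2 ≤ (2 * (1 + c) ^ 2 * Real.exp c + c * Real.exp c) ^ 2 :=
    fun x => pair_step_sq_increment hinj hhub hsum hA hB hS hSrs hG hΦ hJ₁0 hJ₂0 hJ₁ hJ₂ x
  have hR : ∀ x, ∑ y, Sl x y * (Φ y - Φ x) ^ 2 ≤ q * (2 * (1 + c) ^ 2 * Real.exp c + c * Real.exp c) ^ 2 := by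
    intro x
    have e : ∀ y, Sl x y * (Φ y - Φ x) ^ 2 = q * (Sst x y * (Φ y - Φ x) ^ 2) + (1 - q) * ((if x = y then (1 : ℝ) else 0) * (Φ y - Φ x) ^ 2) :=
      fun y => by rw [hSl']; ring
    rw [sum_congr rfl fun y _ => e y, sum_add_distrib, ← mul_sum, ← mul_sum]
    have h0 : ∑ y, (if x = y then (1 : ℝ) else 0) * (Φ y - Φ x) ^ 2 = 0 := by
      simp only [ite_mul, one_mul, zero_mul, Finset.sum_ite_eq, Finset.mem_univ, if_true, sub_self]; ring
    rw [h0, mul_zero, add_zero]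
    exact mul_le_mul_of_nonneg_left (hRS x) hq0.le
  -- file 1's constants
  have hlam1 : lam < 1 := by rw [hlamdef]; have := div_pos (mul_pos hq0 hΛb.1) hK0; linarith
  have hqΛK : q * Λ / K < 1 := by
    rw [div_lt_one hK0]
    have : q * Λ ≤ 1 * Λ := mul_le_mul_of_nonneg_right hq1 hΛb.1.le
    linarith [hΛb.2.2]
  have hlam0 : 0 < lam := by rw [hlamdef]; linarith
  have h1lam : 1 - lam = q * Λ / K := by rw [hlamdef]; ring
  have hδ0 : 0 ≤ δ := by rw [hδdef]; have := hcc.1; positivity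
  have hqδ0 : 0 ≤ q * δ := mul_nonneg hq0.le hδ0
  have hδE : δ ≤ 4 * E₁ / K := by rw [hδdef]; exact div_le_div_of_nonneg_right hJc.2.1 hK0.le
  have hR0 : 0 ≤ q * (2 * (1 + c) ^ 2 * Real.exp c + c * Real.exp c) ^ 2 := mul_nonneg hq0.le (sq_nonneg _)
  have hR9 : (2 * (1 + c) ^ 2 * Real.exp c + c * Real.exp c) ^ 2 ≤ 9 * E₁ ^ 2 := hJc.2.2
  set D : ℝ := 7 * E₁ * Real.sqrt (K : ℝ) / Λ with hDdef
  have hDpos : 0 < D := by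
    rw [hDdef]
    have h1 : 0 < Real.sqrt (K : ℝ) := Real.sqrt_pos.mpr hK0
    have h2 : 0 < E₁ := by linarith
    exact div_pos (by positivity) hΛb.1
  -- `q` cancels in file 1's variance budget and in the mean shift
  have hcancel1 : (q * (2 * (1 + c) ^ 2 * Real.exp c + c * Real.exp c) ^ 2 + 2 * (q * δ) ^ 2 / (1 - lam)) / (1 - lam)
      = ((2 * (1 + c) ^ 2 * Real.exp c + c * Real.exp c) ^ 2 + 2 * δ ^ 2 / (Λ / K)) / (Λ / K) := by
    rw [h1lam]; field_simp
  have hcancel2 : 2 * (q * δ) / (1 - lam) = 2 * δ / (Λ / K) := by rw [h1lam]; field_simp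
  have hDsq : (q * (2 * (1 + c) ^ 2 * Real.exp c + c * Real.exp c) ^ 2 + 2 * (q * δ) ^ 2 / (1 - lam)) / (1 - lam) ≤ D ^ 2 := by
    rw [hcancel1, hDdef]
    exact persistent_floor_constants hΛb.1 hΛb.2.2.le hK1r hδ0 hδE hR9
  -- the crowded start
  have hG₁ : Gc x₁ = K := by rw [hG, hcx₁, if_pos hx₁]; simp
  have hΦ₁ : Φ x₁ = f K + κ K := by rw [hΦ, hG₁, if_pos hx₁]
  have hstart : (K : ℝ) * (1 - gs) * Real.exp (-c) ≤ |Φ x₁| := by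
    rw [hΦ₁]
    exact (pairEigen_start_crowded hσ0 hσ1 hα0 hα1 hβ0 hβ1 hp0 hp1 hcbar hgs hD0 hγ hc hf hκ hK1).trans (le_abs_self _)
  -- the time is below file 1's threshold
  have hcoef : lam / (1 - lam) = (K : ℝ) / (q * Λ) - 1 := by
    rw [hlamdef]; field_simp [hΛb.1.ne', hq0.ne']; ring
  have hcoef0 : 0 ≤ (K : ℝ) / (q * Λ) - 1 := by
    rw [sub_nonneg, le_div_iff₀ (mul_pos hq0 hΛb.1)]
    have : q * Λ ≤ 1 * Λ := mul_le_mul_of_nonneg_right hq1 hΛb.1.le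
    linarith [hΛb.2.2]
  have hlog : Real.log K / 2 - Real.log (72 * (1 + c) ^ 2 * Real.exp (2 * c) / ((1 - gs) * Λ)) ≤ Real.log (|Φ x₁| / (2 * (q * δ) / (1 - lam) + 4 * D)) := by
    have hδΛ : δ / (Λ / K) ≤ 4 * E₁ / Λ := by
      rw [div_div_eq_mul_div]
      apply div_le_div_of_nonneg_right _ hΛb.1.le
      calc δ * K ≤ 4 * E₁ / K * K := mul_le_mul_of_nonneg_right hδE hK0.le
        _ = 4 * E₁ := by field_simp
    have hη : 0 < 1 - gs := sub_pos.mpr hgsb.2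
    have hl := persistent_floor_log_eta hΛb.1 hK1r hE₁1 hδ0 hδΛ hη hstart
    have e : 36 * E₁ * Real.exp c / ((1 - gs) * Λ) = 72 * (1 + c) ^ 2 * Real.exp (2 * c) / ((1 - gs) * Λ) / 2 := by
      rw [hE₁def, show (2 : ℝ) * c = c + c by ring, Real.exp_add]; ring
    have hη' : 0 < (1 - gs) * Λ := mul_pos hη hΛb.1
    have hpos : 0 < 72 * (1 + c) ^ 2 * Real.exp (2 * c) / ((1 - gs) * Λ) := by
      have := hcc.1
      positivity
    have e' : Real.log (36 * E₁ * Real.exp c / ((1 - gs) * Λ)) ≤ Real.log (72 * (1 + c) ^ 2 * Real.exp (2 * c) / ((1 - gs) * Λ)) := by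
      rw [e]
      exact Real.log_le_log (half_pos hpos) (half_le_self hpos.le)
    rw [hcancel2, hDdef]
    exact le_trans (sub_le_sub_left e' _) hl
  -- `λⁿ|Φ(x₁)| ≥ M`
  set M : ℝ := 2 * (q * δ) / (1 - lam) + 4 * D with hMdef
  have hM1 : 0 ≤ 2 * (q * δ) / (1 - lam) := by
    rw [h1lam]
    have := hΛb.1
    positivity
  have hMpos : 0 < M := by rw [hMdef]; exact add_pos_of_nonneg_of_pos hM1 (mul_pos (by norm_num) hDpos)
  have hgs1 : (0 : ℝ) < 1 - gs := sub_pos.mpr hgsb.2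
  have hΦpos : 0 < |Φ x₁| := lt_of_lt_of_le (by positivity) hstart
  have hn' : (n : ℝ) ≤ lam / (1 - lam) * Real.log (|Φ x₁| / M) := by
    rw [hcoef]
    exact hn.trans (mul_le_mul_of_nonneg_left hlog hcoef0)
  have h1 : (n : ℝ) * (1 - lam) / lam ≤ Real.log (|Φ x₁| / M) := by
    have h1l : 0 < 1 - lam := by linarith
    have := mul_le_mul_of_nonneg_left hn' (div_pos h1l hlam0).le
    have e1 : (1 - lam) / lam * (lam / (1 - lam) * Real.log (|Φ x₁| / M)) = Real.log (|Φ x₁| / M) := by field_simp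
    have e2 : (1 - lam) / lam * (n : ℝ) = n * (1 - lam) / lam := by ring
    rw [e1, e2] at this
    exact this
  have h2 : M ≤ lam ^ n * |Φ x₁| := by
    calc M = Real.exp (-Real.log (|Φ x₁| / M)) * |Φ x₁| := by rw [Real.exp_neg, Real.exp_log (div_pos hΦpos hMpos)]; field_simp
      _ ≤ Real.exp (-(n * (1 - lam) / lam)) * |Φ x₁| := mul_le_mul_of_nonneg_right (Real.exp_le_exp.mpr (neg_le_neg h1)) hΦpos.le
      _ ≤ lam ^ n * |Φ x₁| := mul_le_mul_of_nonneg_right (lam_pow_ge_exp hlam0 n) hΦpos.le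
  rw [hMdef] at h2
  exact approxEigen_tvDist_ge_half hSlrs hdef hlam0.le hlam1 hR0 hR (fun x => (hπ x).le) hπ1 hst hDpos hDsq x₁ n h2

end ColdStart

section SchemeColdStart
variable {S : Type*} [Fintype S] [DecidableEq S] {K m : ℕ} (κ : Fin m → Fin K) {μ : Fin (K + 1) → S → ℝ} {M : Fin (K + 1) → S → S → ℝ} {w : Fin (K + 1) → ℝ} {t : ℝ} {c : ℕ}
variable {X : Type*} [Fintype X] [DecidableEq X] {hub : X → S} {comp : X → S → ℕ} {W : S → ℝ} {acc : S → S → ℝ} {Kh : (S → ℕ) → S → S → ℝ}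
variable {Ast Bst Sl : X → X → ℝ} {g : (S → ℕ) → ℝ} {πS : X → ℝ} {Z : ℝ}
variable {Λ : (Fin (K + 1) → S) → X}

/-- **FROM THE CONFIGURATION `y_u ≡ u` THE VENTURE's HOMOGENEOUS SCHEME IS NOT HALF-MIXED BEFORE `(K/((t+h)Λ) − 1)·(½·log K − log(72(1+c)²e^{2c}/((1−g⋆)Λ)))`** (`h = (1−t)w_0`,
`σ = t/(t+h)`, persistence `W = μ_1/μ_0` constant off `u`): for every `n` below the bound, the POOLED law is at distance `≥ ½` from `π_S` and the CONFIGURATION law at distance `≥ ½`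
from `μ_0⊗μ_1⊗⋯⊗μ_1` (AD9's push-forward identity; AD15; AE15). [ours] -/
theorem homStar_coldStart_tvDist_ge_half [Nonempty X] (hm : 1 ≤ m) (hμ : ∀ k x, 0 < μ k x) (hμsum : ∀ k, ∑ u, μ k u = 1)
    (hhom : ∀ i : Fin K, μ i.succ = μ 1) (hw0 : ∀ k, 0 ≤ w k) (hw00 : 0 < w 0) (hw1 : ∑ k, w k = 1) (ht0 : 0 < t) (ht1 : t < 1)
    (hM0 : ∀ u v, M 0 u v = μ 0 v) (hidle : ∀ i : Fin K, ∀ u v, M i.succ u v = if v = u then 1 else 0)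
    (hunif : ∀ i : Fin K, (univ.filter fun r : Fin m => κ r = i).card = c)
    (hWdef : ∀ v, W v = μ 1 v / μ 0 v) (hinj : ∀ x x', hub x = hub x' → comp x = comp x' → x = x') (hsum : ∀ x, ∑ v, comp x v = K + 1)
    (hsurj : ∀ (z : S) (N : S → ℕ), ∑ v, N v = K + 1 → N z ≠ 0 → ∃ x, hub x = z ∧ comp x = N) (hhub : ∀ x, comp x (hub x) ≠ 0) (hK : 2 ≤ K)
    (hacc : ∀ h v, acc h v = min 1 (W h / W v))
    (hKoff : ∀ N h v, h ≠ v → Kh N h v = if N h = 0 then 0 else (N v : ℝ) / K * acc h v) (hKdiag : ∀ N h, Kh N h h = 1 - ∑ v ∈ univ.erase h, Kh N h v)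
    (hA : ∀ x x', Ast x x' = if comp x' = comp x then Kh (comp x) (hub x) (hub x') else 0)
    (hB : ∀ x x', Bst x x' = μ 0 (hub x') * (if comp x' + Pi.single (hub x) 1 = comp x + Pi.single (hub x') 1 then 1 else 0))
    (hSl : ∀ x x', Sl x x' = t * Ast x x' + (1 - t) * (w 0 * Bst x x' + (1 - w 0) * (if x = x' then 1 else 0)))
    (hg : ∀ N, g N = ∏ v, (μ 0 v * W v) ^ (N v) / ((N v).factorial : ℝ))
    (hZ : Z = ∑ x, g (comp x) * ((comp x (hub x) : ℝ) / W (hub x))) (hπS : ∀ x, πS x = g (comp x) * ((comp x (hub x) : ℝ) / W (hub x)) / Z)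
    (hΛh : ∀ y, hub (Λ y) = y 0) (hΛc : ∀ y v, comp (Λ y) v = (univ.filter fun k : Fin (K + 1) => y k = v).card)
    (u w' : S) (hw' : w' ≠ u) {α β σ : ℝ} (hα0 : 0 < α) (hα1 : α ≤ 1) (hβ0 : 0 < β) (hβ1 : β ≤ 1)
    (hαu : ∀ v, v ≠ u → acc u v = α) (hβu : ∀ v, v ≠ u → acc v u = β) (hσ : σ = t / (t + (1 - t) * w 0)) (hKσ : σ ≤ (1 - σ) * K)
    {cbar gs D0 Λr γ cc : ℝ} (hcbar : cbar = μ 0 u * α + (1 - μ 0 u) * β) (hgs : gs = μ 0 u * α / cbar) (hD0 : D0 = (1 - σ) + σ * α * β / cbar)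
    (hΛr : Λr = σ * (1 - σ) * cbar / D0) (hγ : γ = σ * (β - α) / D0) (hc : cc = σ / D0) {n : ℕ}
    (hn : (n : ℝ) ≤ ((K : ℝ) / ((t + (1 - t) * w 0) * Λr) - 1) * (Real.log K / 2 - Real.log (72 * (1 + cc) ^ 2 * Real.exp (2 * cc) / ((1 - gs) * Λr)))) :
    1 / 2 ≤ tvDist (fun x' => ∑ z ∈ univ.filter (fun z => Λ z = x'),
          lawAt (fun y z : Fin (K + 1) → S => t * ptGraphSwap μ
            (fun r : Fin m => (((0 : Fin (K + 1)), (κ r).succ) : Fin (K + 1) × Fin (K + 1))) (fun _ => Equiv.refl S) y z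
            + (1 - t) * prodKernel w M y z) (Pi.single (fun _ : Fin (K + 1) => u) 1) n z) πS ∧
    1 / 2 ≤ tvDist (lawAt (fun y z : Fin (K + 1) → S => t * ptGraphSwap μ
            (fun r : Fin m => (((0 : Fin (K + 1)), (κ r).succ) : Fin (K + 1) × Fin (K + 1))) (fun _ => Equiv.refl S) y z
            + (1 - t) * prodKernel w M y z) (Pi.single (fun _ : Fin (K + 1) => u) 1) n) (tensorFun μ) := by
  classical
  have hK1 : 1 ≤ K := by omega
  have hW : ∀ v, 0 < W v := fun v => by rw [hWdef]; exact div_pos (hμ 1 v) (hμ 0 v)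
  have hw0le : w 0 ≤ 1 := by
    have := Finset.single_le_sum (fun k _ => hw0 k) (mem_univ (0 : Fin (K + 1))); rw [hw1] at this; exact this
  have h1t : 0 < 1 - t := by linarith
  have hh0 : 0 < (1 - t) * w 0 := mul_pos h1t hw00
  have hth : t + (1 - t) * w 0 ≤ 1 := by nlinarith
  have hSl' : ∀ x x', Sl x x' = t * Ast x x' + ((1 - t) * w 0) * Bst x x' + (1 - t - (1 - t) * w 0) * (if x = x' then 1 else 0) :=
    fun x x' => by rw [hSl]; ring
  -- the crowded lumped state `x₁ = Λ y_u`
  set yu : Fin (K + 1) → S := fun _ => u with hyu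
  have hx₁ : hub (Λ yu) = u := by rw [hΛh]
  have hcx₁ : comp (Λ yu) = fun v => if v = u then K + 1 else 0 := by
    funext v
    rw [hΛc]
    by_cases hv : v = u
    · subst hv
      rw [if_pos rfl, Finset.filter_true_of_mem (fun k _ => rfl), Finset.card_univ, Fintype.card_fin]
    · rw [if_neg hv, Finset.card_eq_zero, Finset.filter_eq_empty_iff]
      intro k _ hk
      exact hv hk.symm
  have hlump := lumpedStar_lazy_coldStart_tvDist_ge_half hinj hsurj hhub hsum hK hW hacc (hμsum 0) (hμ 0) ht0 hh0 hth hσ hKσ hKoff hKdiag hA hB hSl' hg hZ hπS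
    u w' hw' hα0 hα1 hβ0 hβ1 hαu hβu hcbar hgs hD0 hΛr hγ hc (Λ yu) hx₁ hcx₁ hn
  -- AD9: the pooled law from `y_u` is `δ_{x₁}S_lⁿ`
  have hacc' : ∀ a b, acc a b = min 1 (μ 0 b * μ 1 a / (μ 0 a * μ 1 b)) := by
    intro a b
    rw [hacc, hWdef, hWdef]
    congr 1
    field_simp [(hμ 0 a).ne', (hμ 0 b).ne', (hμ 1 a).ne', (hμ 1 b).ne']
  have hpush := homStar_pushforward_lawAt κ hm hμ hhom hw1 hM0 hidle hunif hacc' hKoff hKdiag hA hB hSl hΛh hΛc hinj (Pi.single yu 1) n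
  have hδ : (fun x' => ∑ y' ∈ univ.filter (fun y' => Λ y' = x'), (Pi.single yu (1 : ℝ) : (Fin (K + 1) → S) → ℝ) y') = Pi.single (Λ yu) 1 :=
    funext fun x' => lumping_pushforward_single yu x'
  rw [hδ] at hpush
  refine ⟨by rw [hpush]; exact hlump, ?_⟩
  -- AD15 + AE15: the configuration law is no closer to `⊗μ` than its image to `π_S`
  have hπ : ∀ x, πS x = ∑ y ∈ univ.filter (fun y => Λ y = x), tensorFun μ y := fun x =>
    homStar_piS_eq_pushforward κ hm hμ hμsum hhom hw0 hw00 hw1 ht0 ht1 hM0 hidle hunif hWdef hinj hsum hsurj hhub hK1 hacc hKoff hKdiag hA hB hSl hg hZ hπS hΛh hΛc x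
  have hπfun : πS = fun x => ∑ y ∈ univ.filter (fun y => Λ y = x), tensorFun μ y := funext hπ
  have hcfg := tvDist_pushforward_le Λ (lawAt (fun y z : Fin (K + 1) → S => t * ptGraphSwap μ
            (fun r : Fin m => (((0 : Fin (K + 1)), (κ r).succ) : Fin (K + 1) × Fin (K + 1))) (fun _ => Equiv.refl S) y z
            + (1 - t) * prodKernel w M y z) (Pi.single yu 1) n) (tensorFun μ)
  rw [hpush, ← hπfun] at hcfg
  exact hlump.trans hcfg

end SchemeColdStart

end Summit.Ventures.LatticeQCDFlow.Scaling

end
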